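import Literature.IUT.HodgeArakelov.LabelClassesOfCusps

/-!
# [IUTchII] Cor 2.4 (ii)(iii), repaired typing `Cor24_ii_iii'` (binders of the printed family)

Repair file (abc-iut cell; RQ7 findings L6t1-F1 (abc-iut-L6-t20), F9 (abc-iut-L6-d1), G11 negative
`not_Cor24_ii_iii_of_Cor24_indices` (abc-iut-L6-t19, `LabelClassesOfCuspsNegative.lean`); abc-iut-L6-lead's
ruling 2026-08-25T20:42:11Z (3)). The landed `Cor24_ii_iii W C H` quantifies its first conjunct over ALL
subgroups `I ⊆ Π̂^cor_v` — in particular `I = {1}`, whose "decomposition group" `N(1)` is everything — and is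
thereby refutable for every tower satisfying the printed indices. PRINT ([IUTchII] Cor. 2.4, kurims
pp. 69–70) binds the family: "Let `I_t ⊆ Π_v` be a cuspidal inertia group that belongs to the class determined
by `t` such that `I_t ⊆ Δ_{v□}`" (i), "`δ := γ·γ' ∈ Δ̂^±_v`, then any inclusion `I^δ_t ⊆ Π^δ_{v□}` … completely
determines the following data: (a) a decomposition group `D^δ_t := N_{Π^δ_v}(I^δ_t) ⊆ Π^δ_{v□̈}` …; (b) …
`D^δ_{μ_-}` …; (c) … `D^δ_{t,μ_-} ⊆ Π^δ_{v□̈}` … Moreover, the construction … is compatible with conjugation by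
arbitrary `δ ∈ Δ̂^±_v`" (ii), and "(iii) Suppose that `□ = •t`. Then the construction of the data of (ii),
(a), (c), is compatible with conjugation by arbitrary `δ ∈ Π̂^cor_v`". Here `Cor24_ii_iii'` quantifies over
EXACTLY that family — cuspidal inertia groups `I` of `Π_v` (`C.IsCuspidalInertia Π_v I`) inside `Δ_{v□}`
(`I ≤ W.deltaBox H`) — uses the `∃`-bound data's own `D_t`, and states the equivariance for all
`δ ∈ Π̂^cor_v` (case (iii); it contains (ii)'s `Δ̂^±_v`). DISCLOSURE (`cor24_ii_iii'_iff`): as the interface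
carries the data (b), (c) WITHOUT their defining property (decomposition groups of `μ_-`-translates,
[SemiAnbd] Thm. 6.8 (iii) — not in the tree), the `∃ data` clause is canonically inhabited and the
predicate is EQUIVALENT to its clause (a): `N_{Π^δ_v}(I^δ) ⊆ Π^δ_{v□̈}` for every cuspidal inertia
`I ⊆ Δ_{v□}` and every `δ` — the one piece of printed content the typing can presently hold.

Claim key `Mochizuki2012`, status DISPUTED (D-0012): typing only; nothing here takes a side on [IUTchIII]
Cor. 3.12 (typed ≠ discharged).
-/

namespace Literature.IUT.HodgeArakelov

universe u

variable {S : BadPlaceSetting.{u}} {P : TopGroup.{u}} {T : TemperedCoverings S P}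

/-- `D^δ_t := N_{Π^δ_v}(I^δ_t)` ([IUTchII] Cor. 2.4 (ii)(a), p. 70) as a function of `(I, δ)` alone — the same
formula as `TwoTorsionTranslates.Dt`, which does not use its structure argument (`dt_eq_cuspDecomp`).
[claim: Mochizuki2012, status: disputed] -/
def PlusMinusTower.cuspDecomp (W : PlusMinusTower T) (I : Subgroup W.Corhat) (δ : W.Corhat) :
    Subgroup W.Corhat :=
  (Subgroup.normalizer (((I.map (MulAut.conj δ).toMonoidHom).subgroupOf
      (W.piV.map (MulAut.conj δ).toMonoidHom) : Subgroup (W.piV.map (MulAut.conj δ).toMonoidHom)) :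
        Set (W.piV.map (MulAut.conj δ).toMonoidHom))).map
    (W.piV.map (MulAut.conj δ).toMonoidHom).subtype

/-- `TwoTorsionTranslates.Dt` is `cuspDecomp` (definitional). [claim: Mochizuki2012, status: disputed] -/
theorem TwoTorsionTranslates.dt_eq_cuspDecomp {W : PlusMinusTower T} {H : Subgroup P}
    {I : Subgroup W.Corhat} {δ : W.Corhat} (X : TwoTorsionTranslates W H I δ) :
    X.Dt = W.cuspDecomp I δ := rfl

/-- **IUTchII:Cor2.4(ii)(iii)** (kurims p. 70), REPAIRED typing (binders of the printed family): there is an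
assignment, to every CUSPIDAL INERTIA group `I ⊆ Π_v` lying in `Δ_{v□}` and every `δ ∈ Π̂^cor_v`, of the data
(a) `D^δ_t` [DEFINED, `Dt`], (b) `D^δ_{μ_-}`, (c) `D^δ_{t,μ_-} ⊆ Π^δ_{v□̈}` of Cor. 2.4 (ii), such that
(a) `D^δ_t ⊆ Π^δ_{v□̈}` and the construction is compatible with conjugation by arbitrary `δ ∈ Π̂^cor_v`
((ii): `Δ̂^±_v`; (iii), `□ = •t`: `Π̂^cor_v`). The inclusion `I^δ ⊆ Π^δ_{v□}` "as in (i)" is automatic from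
`I ⊆ Δ_{v□}` and is supplied by the data. Replaces `Cor24_ii_iii` (PRE-REPAIR: refutable, see
`LabelClassesOfCuspsNegative`). [claim: Mochizuki2012, status: disputed] -/
def Cor24_ii_iii' (W : PlusMinusTower T) (C : CuspidalInertiaData W) (H : Subgroup P) : Prop :=
  ∃ data : ∀ (I : Subgroup W.Corhat) (δ : W.Corhat),
      C.IsCuspidalInertia W.piV I → I ≤ W.deltaBox H → TwoTorsionTranslates W H I δ,
    (∀ (I : Subgroup W.Corhat) (δ : W.Corhat) (hI : C.IsCuspidalInertia W.piV I) (hIΔ : I ≤ W.deltaBox H),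
        (data I δ hI hIΔ).Dt ≤ (W.boxDd H).map (MulAut.conj δ).toMonoidHom) ∧
      ∀ (I : Subgroup W.Corhat) (δ ε : W.Corhat) (hI : C.IsCuspidalInertia W.piV I)
        (hIΔ : I ≤ W.deltaBox H),
        (data I (ε * δ) hI hIΔ).Dtmu = ((data I δ hI hIΔ).Dtmu).map (MulAut.conj ε).toMonoidHom

/-! ### The content of the repaired predicate -/

section

variable {G : Type u} [Group G]

/-- Conjugation by a product is iterated conjugation on subgroups. [folklore] -/
private theorem map_conj_mul (K : Subgroup G) (ε δ : G) :
    K.map (MulAut.conj (ε * δ)).toMonoidHom =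
      (K.map (MulAut.conj δ).toMonoidHom).map (MulAut.conj ε).toMonoidHom := by
  ext x
  rw [Subgroup.mem_map_equiv, Subgroup.mem_map_equiv, Subgroup.mem_map_equiv, MulAut.conj_symm_apply,
    MulAut.conj_symm_apply, MulAut.conj_symm_apply, mul_inv_rev]
  constructor <;> intro h <;> simpa [mul_assoc] using h

end

/-- DISCLOSURE / content lemma: since the interface carries the data (b) `D^δ_{μ_-}`, (c) `D^δ_{t,μ_-}` without
their defining property ([SemiAnbd] Thm. 6.8 (iii), not in the tree), the `∃ data` clause of
`Cor24_ii_iii'` is canonically inhabited (take `D^δ_{μ_-} = D^δ_{t,μ_-} := Π^δ_{v□̈}`), so the repaired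
predicate is EQUIVALENT to its clause (a): `D^δ_t = N_{Π^δ_v}(I^δ) ⊆ Π^δ_{v□̈}` for every cuspidal inertia
`I ⊆ Δ_{v□}` and every `δ ∈ Π̂^cor_v` ([IUTchII] Cor. 2.4 (ii)(a), p. 70). [claim: Mochizuki2012, status: disputed] -/
theorem cor24_ii_iii'_iff (W : PlusMinusTower T) (C : CuspidalInertiaData W) (H : Subgroup P) :
    Cor24_ii_iii' W C H ↔
      ∀ (I : Subgroup W.Corhat), C.IsCuspidalInertia W.piV I → I ≤ W.deltaBox H →
        ∀ δ : W.Corhat, W.cuspDecomp I δ ≤ (W.boxDd H).map (MulAut.conj δ).toMonoidHom := by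
  constructor
  · rintro ⟨data, hDt, -⟩ I hI hIΔ δ
    rw [← (data I δ hI hIΔ).dt_eq_cuspDecomp]
    exact hDt I δ hI hIΔ
  · intro h
    refine ⟨fun I δ _ hIΔ =>
      { incl := Subgroup.map_mono (le_trans hIΔ inf_le_left)
        Dmu := (W.boxDd H).map (MulAut.conj δ).toMonoidHom
        Dtmu := (W.boxDd H).map (MulAut.conj δ).toMonoidHom
        Dtmu_le := le_rfl }, fun I δ hI hIΔ => ?_, fun I δ ε hI hIΔ => ?_⟩
    · exact h I hI hIΔ δ
    · exact map_conj_mul _ ε δ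

end Literature.IUT.HodgeArakelov
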